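import Summits.Ventures.YMGap.Thresholds.StarLimitMassiveSUN
import Summits.Ventures.YMGap.Thresholds.StarSUNRows
import HarnessLib

/-!
# Venture YMGap — track (c) «DS»: the massive-state rows for EVERY `SU(N)` — every DLR state (not only
# every limit state) is massive at `|β|/N ≤ 9/308`, and the `SU(3)` rows in Wilson units

HONEST FRAMING: venture file (cell `pub-ymgap`, PLAN R128(b)(ii); ds-3), strong-coupling LATTICE statements only,
for `SU(N)` lattice Yang–Mills on `ℤ⁴` with the Wilson plaquette weight `exp(−β (N − Re tr U_q))` at tree coupling
`β`; ARITHMETIC over tree theorems: the limit-state rows `StarSUNMassive.isMassiveState_SU_star` /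
`isMassiveState_of_oneLinkKRModulus` (`StarLimitMassiveSUN.lean`), ds-1's two-sided DLR uniqueness
`StarSUN.hasUniqueGibbsMeasure_abs` / `hasUniqueGibbsMeasure_of_oneLinkKRModulus` (`StarSUNRows.lean`), the DLR
facts `infiniteVolumeLimitPoints_nonempty_holds` / `mem_ymGibbsMeasures_of_mem_infiniteVolumeLimitPoints_holds`,
and pub-balaban's variance modulus `oneLinkKRModulus_of_varianceBound` (ONE conditional `SU(3)` row).  Nothing
about the `MassGapAt`/`ImprovedThreshold` currency (ds-1's `StarMassGapSUN`), the continuum, confinement or a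
transfer-matrix gap; no `d ≠ 4`.

* `isMassiveState_of_mem_ymGibbsMeasures_of_oneLinkKRModulus`, ★ `isMassiveState_dlr_SU_star (hN : 2 ≤ N)
  (h : |β|/N ≤ 9/308) : ∀ μ ∈ ymGibbsMeasures (fundamentalRep (Fin N)) β, IsMassiveState μ` — EVERY DLR state
  (uniqueness makes it the limit state), and `hasExponentialDecay_plaquetteCorrFn_dlr_SU_star`;
* `SU(3)` in Wilson units `β_W = 6/g²` (tree coupling `β_W/3`, 't Hooft `β_W/9`): `su3_isMassiveState_abs_le` /
  `su3_hasExponentialDecay_plaquetteCorrFn_abs_le` / `su3_isMassiveState_dlr_abs_le` (`|β_W| ≤ 81/308 = 0.2629…`,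
  hypothesis-free, two-sided) and the CONDITIONAL rows `…_of_varianceBound_abs_le` (`|β_W| ≤ 21/50` GIVEN the
  C-iv-certified `OneLinkVarianceBound 3 (11/30) (49/20)`, the displayed hypothesis of the tree's
  `SlabAreaLawVariance` rows; class «K × C-iv», not K);
* `massive_numbers`.

Comparison: `SU(2)` keeps ds-2's sharper rows `su2_isMassiveState_le_9_25` /
`su2_hasExponentialDecay_plaquetteCorrFn_le_9_25` (Wilson `β_W ≤ 9/25`, 't Hooft `9/100`); their DLR-state and
two-sided forms are in `CouplingSignFlipMassive.lean` (ds-3).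
-/

noncomputable section

open MeasureTheory
open Literature.Probability.LatticeModels
open Literature.MathematicalPhysics.QuantumLattice (LGConfig fundamentalRep infiniteVolumeLimitPoints
  ymSpecification ymGibbsMeasures plaquetteCorrFn continuous_fundamentalRep
  mem_ymGibbsMeasures_of_mem_infiniteVolumeLimitPoints_holds infiniteVolumeLimitPoints_nonempty_holds)
open Literature.MathematicalPhysics.QuantumFieldTheory
open Literature.MathematicalPhysics.QuantumFieldTheory.Balaban1983to89.StrongCouplingDobrushinWindow
  (OneLinkKRModulus)
open Summit.QuantumFields.BalabanUV.InfraRed.StrongCouplingVarianceDoorSUN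
  (OneLinkVarianceBound oneLinkKRModulus_of_varianceBound)
open Literature.Barriers.QuantumFields (IsMassiveState)

namespace Summit.Ventures.YMGap.StarSUNMassive

variable {N : ℕ}

/-! ### Every DLR state is massive (uniqueness makes it the limit state) -/

/-- **Every DLR state is massive, from a one-link modulus** (`SU(N)`, `N ≥ 1`): under `OneLinkKRModulus N R K`,
`K ≥ 0`, `R ≥ 6|β|/N`, `4K|β|/N ≤ 9/25`, the DLR state of the `ℤ⁴` specification at tree coupling `β` is unique
(ds-1's `StarSUN.hasUniqueGibbsMeasure_of_oneLinkKRModulus`), hence equal to any infinite-volume limit point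
(`infiniteVolumeLimitPoints_nonempty_holds`, `mem_ymGibbsMeasures_of_mem_infiniteVolumeLimitPoints_holds`), which
is massive by `isMassiveState_of_oneLinkKRModulus`. [folklore] -/
theorem isMassiveState_of_mem_ymGibbsMeasures_of_oneLinkKRModulus (hN : 1 ≤ N) {β R K : ℝ} (hK0 : 0 ≤ K)
    (hR : |β| / N * 6 ≤ R) (hmod : OneLinkKRModulus N R K) (h : 4 * (K * (|β| / N)) ≤ 9 / 25) :
    ∀ μ ∈ ymGibbsMeasures (d := 4) (fundamentalRep (Fin N)) β, IsMassiveState μ := by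
  intro μ hμ
  haveI : SecondCountableTopology (Matrix (Fin N) (Fin N) ℂ) :=
    inferInstanceAs (SecondCountableTopology (Fin N → Fin N → ℂ))
  haveI : SecondCountableTopology (Matrix.specialUnitaryGroup (Fin N) ℂ) :=
    Topology.IsEmbedding.subtypeVal.secondCountableTopology
  have hρc := continuous_fundamentalRep (Fin N)
  obtain ⟨ν, hν⟩ := infiniteVolumeLimitPoints_nonempty_holds (d := 4) (fundamentalRep (Fin N)) hρc β
  have hνG : ν ∈ ymGibbsMeasures (d := 4) (fundamentalRep (Fin N)) β :=
    mem_ymGibbsMeasures_of_mem_infiniteVolumeLimitPoints_holds (d := 4) (fundamentalRep (Fin N)) hρc hν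
  have hμν : μ = ν := (StarSUN.hasUniqueGibbsMeasure_of_oneLinkKRModulus hN hK0 hR hmod h).1 hμ hνG
  rw [hμν]
  exact isMassiveState_of_oneLinkKRModulus hN hK0 hR hmod h ν hν

/-- ★ **EVERY DLR STATE OF `SU(N)` LATTICE YANG–MILLS ON `ℤ⁴` (Wilson, EVERY `N ≥ 2`) IS MASSIVE at every tree
coupling `|β|/N ≤ 9/308`** (NO hypothesis): the DLR state is unique (ds-1's `StarSUN.hasUniqueGibbsMeasure_abs`)
and equal to the limit state, which is massive (`isMassiveState_SU_star`). [folklore] -/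
theorem isMassiveState_dlr_SU_star (hN : 2 ≤ N) {β : ℝ} (h : |β| / N ≤ 9 / 308) :
    ∀ μ ∈ ymGibbsMeasures (d := 4) (fundamentalRep (Fin N)) β, IsMassiveState μ := by
  obtain ⟨h1, hK0, h4⟩ := StarSUN.bakryEmery_coef_le_abs (by omega) h
  exact isMassiveState_of_mem_ymGibbsMeasures_of_oneLinkKRModulus (by omega) hK0 le_rfl
    (Balaban1983to89.StrongCouplingKernelWindow.oneLinkKRModulus_SU hN h1) h4

/-- ★ **Exponential decay of the plaquette–plaquette correlation function of EVERY DLR STATE** of `SU(N)` lattice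
Yang–Mills on `ℤ⁴` (EVERY `N ≥ 2`) at every tree coupling `|β|/N ≤ 9/308` (NO hypothesis). [folklore] -/
theorem hasExponentialDecay_plaquetteCorrFn_dlr_SU_star (hN : 2 ≤ N) {β : ℝ} (h : |β| / N ≤ 9 / 308) :
    ∀ μ ∈ ymGibbsMeasures (d := 4) (fundamentalRep (Fin N)) β,
      HasExponentialDecay (plaquetteCorrFn (fundamentalRep (Fin N)) μ) := by
  intro μ hμ
  haveI : SecondCountableTopology (Matrix (Fin N) (Fin N) ℂ) :=
    inferInstanceAs (SecondCountableTopology (Fin N → Fin N → ℂ))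
  haveI : SecondCountableTopology (Matrix.specialUnitaryGroup (Fin N) ℂ) :=
    Topology.IsEmbedding.subtypeVal.secondCountableTopology
  have hρc := continuous_fundamentalRep (Fin N)
  obtain ⟨ν, hν⟩ := infiniteVolumeLimitPoints_nonempty_holds (d := 4) (fundamentalRep (Fin N)) hρc β
  have hνG : ν ∈ ymGibbsMeasures (d := 4) (fundamentalRep (Fin N)) β :=
    mem_ymGibbsMeasures_of_mem_infiniteVolumeLimitPoints_holds (d := 4) (fundamentalRep (Fin N)) hρc hν
  have hμν : μ = ν := (StarSUN.hasUniqueGibbsMeasure_abs hN h).1 hμ hνG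
  rw [hμν]
  exact hasExponentialDecay_plaquetteCorrFn_SU_star hN h ν hν

/-! ### `SU(3)` rows in Wilson units `β_W = 6/g²` (tree coupling `β_W/3`, 't Hooft `β_W/9`) -/

/-- The `SU(3)` coupling bookkeeping: `|β_W/3| / 3 = |β_W| / 9`. -/
theorem su3_abs_coupling (βW : ℝ) : |βW / 3| / ((3 : ℕ) : ℝ) = |βW| / 9 := by
  rw [abs_div]; push_cast; norm_num; ring

/-- **`SU(3)`, HYPOTHESIS-FREE, TWO-SIDED**: every infinite-volume limit state of `SU(3)` lattice Yang–Mills on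
`ℤ⁴` (tree coupling `β_W/3`) is massive at every Wilson `|β_W| ≤ 81/308 = 0.2629…`. [folklore] -/
theorem su3_isMassiveState_abs_le {βW : ℝ} (h : |βW| ≤ 81 / 308) :
    ∀ μ ∈ infiniteVolumeLimitPoints (d := 4) (fundamentalRep (Fin 3)) (βW / 3), IsMassiveState μ :=
  isMassiveState_SU_star (N := 3) (by norm_num) (by rw [su3_abs_coupling]; linarith)

/-- **`SU(3)`, HYPOTHESIS-FREE, TWO-SIDED**: exponential decay of the plaquette–plaquette correlation function of
every infinite-volume limit state at every Wilson `|β_W| ≤ 81/308`. [folklore] -/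
theorem su3_hasExponentialDecay_plaquetteCorrFn_abs_le {βW : ℝ} (h : |βW| ≤ 81 / 308) :
    ∀ μ ∈ infiniteVolumeLimitPoints (d := 4) (fundamentalRep (Fin 3)) (βW / 3),
      HasExponentialDecay (plaquetteCorrFn (fundamentalRep (Fin 3)) μ) :=
  hasExponentialDecay_plaquetteCorrFn_SU_star (N := 3) (by norm_num) (by rw [su3_abs_coupling]; linarith)

/-- **`SU(3)`, CONDITIONAL ROW** (class «K × C-iv», NOT K): GIVEN the one-link variance inequality
`OneLinkVarianceBound 3 (11/30) (49/20)` (certified as a computation by the cell `pub-balaban`, replayed by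
`pub-ymgap`; the displayed hypothesis of the tree's `SlabAreaLawVariance` rows), every infinite-volume limit
state of `SU(3)` lattice Yang–Mills on `ℤ⁴` is massive at every Wilson `|β_W| ≤ 21/50 = 0.42` — pub-balaban's
variance modulus on the smaller ball `R = 7/25 ≥ 6|β_W|/9`, `K = √((49/20)/(3(1/2 − 7/25))) ≤ 27/14`,
`4·(27/14)·|β_W|/9 ≤ 9/25` iff `|β_W| ≤ 21/50` (ds-1's arithmetic in `StarSUNRows`). [folklore] -/
theorem su3_isMassiveState_of_varianceBound_abs_le (hv : OneLinkVarianceBound 3 (11 / 30) (49 / 20))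
    {βW : ℝ} (h : |βW| ≤ 21 / 50) :
    ∀ μ ∈ infiniteVolumeLimitPoints (d := 4) (fundamentalRep (Fin 3)) (βW / 3), IsMassiveState μ := by
  have hv' : OneLinkVarianceBound 3 (7 / 25) (49 / 20) := hv.mono (by norm_num) le_rfl
  have hmod := oneLinkKRModulus_of_varianceBound (N := 3) (by norm_num) (R := 7 / 25) (by norm_num)
    (by norm_num) hv'
  have hK : Real.sqrt (49 / 20 / ((3 : ℕ) * (1 / 2 - 7 / 25))) ≤ 27 / 14 := by
    rw [Real.sqrt_le_left (by norm_num)]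
    norm_num
  have hmod' : OneLinkKRModulus 3 (7 / 25) (27 / 14) := StarSUN.oneLinkKRModulus_mono_const hmod hK
  refine isMassiveState_of_oneLinkKRModulus (N := 3) (by norm_num) (by norm_num) ?_ hmod' ?_
  · rw [su3_abs_coupling]; linarith
  · rw [su3_abs_coupling]; linarith

/-- **`SU(3)`, CONDITIONAL ROW** (class «K × C-iv»): GIVEN `OneLinkVarianceBound 3 (11/30) (49/20)`, the
plaquette–plaquette correlation function of every infinite-volume limit state decays exponentially at every
Wilson `|β_W| ≤ 21/50`. [folklore] -/
theorem su3_hasExponentialDecay_plaquetteCorrFn_of_varianceBound_abs_le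
    (hv : OneLinkVarianceBound 3 (11 / 30) (49 / 20)) {βW : ℝ} (h : |βW| ≤ 21 / 50) :
    ∀ μ ∈ infiniteVolumeLimitPoints (d := 4) (fundamentalRep (Fin 3)) (βW / 3),
      HasExponentialDecay (plaquetteCorrFn (fundamentalRep (Fin 3)) μ) :=
  fun μ hμ => hasExponentialDecay_plaquetteCorrFn_of_isMassiveState hμ
    (su3_isMassiveState_of_varianceBound_abs_le hv h μ hμ)

/-- The numbers side by side ('t Hooft `|β|/N`): printed strong-coupling bar `1/48`, this file `9/308 = (108/77)·(1/48)`;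
`SU(3)` Wilson `81/308 = 9·(9/308)` and the conditional `21/50`; `SU(2)` Wilson `9/25 = 4·(9/100)` (ds-2's
sharper row). [folklore] -/
theorem massive_numbers :
    (1 : ℝ) / 48 < 9 / 308 ∧ (9 : ℝ) / 308 = 108 / 77 * (1 / 48) ∧ (81 : ℝ) / 308 = 9 * (9 / 308) ∧
      (81 : ℝ) / 308 < 21 / 50 ∧ (9 : ℝ) / 25 = 4 * (9 / 100) := by
  norm_num


/-- **`SU(3)`, HYPOTHESIS-FREE, TWO-SIDED: every DLR state** of `SU(3)` lattice Yang–Mills on `ℤ⁴` (tree coupling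
`β_W/3`) is massive at every Wilson `|β_W| ≤ 81/308`. [folklore] -/
theorem su3_isMassiveState_dlr_abs_le {βW : ℝ} (h : |βW| ≤ 81 / 308) :
    ∀ μ ∈ ymGibbsMeasures (d := 4) (fundamentalRep (Fin 3)) (βW / 3), IsMassiveState μ :=
  isMassiveState_dlr_SU_star (N := 3) (by norm_num) (by rw [su3_abs_coupling]; linarith)

end Summit.Ventures.YMGap.StarSUNMassive

end
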